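import Literature.NumberTheory.Automorphic.HermitianSphereEigenvectorCompact      -- ⊙ (F-eig) (+ ★ (F-sec) through it)
import Literature.NumberTheory.Automorphic.UnitaryEigenvectorAnisotropic          -- ⊙ (F-guard)
import Literature.LinearAlgebra.Matrix.UnitaryFormAdjointCayley                   -- ★ `exists_mem_unitaryGroupOfForm_coe_eq`, `mem_unitaryGroupOfForm_iff_formAdjoint_mul_eq_one`
import HarnessLib

/-!
# «COMPACT MODULO THE CENTRALISER»: conjugators of windowed centraliser elements into a compact set lie in `C · Stab(v₁)`, `C` compact
# (Harish-Chandra's compactness lemma for the descent at a singular semisimple point — N6nsGerm (S1), binder (B4-top)(3), field level)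

Topic `NumberTheory/Automorphic`; namespace `Literature.NumberTheory.Automorphic.UnitaryGroup`. KERNEL ONLY: theorems, no definition, no named fact, no instance,
no notation, no `sorry`.  Cell `pub/hodgecm-mathlib` (LEAD F0P3a-plan (g9) T8-38 (1) ∕ T8-65 (2); road «N6nsGerm» (S1): p08 (g13)'s Ad(M)-invariant descent binder B4 needs
«`{x ∣ x U_M x⁻¹ ∩ Ω ≠ ∅}` compact mod `M`»; census `F0/P3a/A-p16/g26/CENSUS-N6nsGerm-S1.A-p16g26.md` §5 (F-asm), field level).

THE STATEMENT (over a proper non-trivially normed field `E` — the `L_w` — with continuous isometric involution `σ`, `J` hermitian with `det J ≠ 0`, `2 ≠ 0`).  Fix an anisotropic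
`v₁` (`β = h(v₁,v₁) ≠ 0`; the `u`-eigenvector of `ε₀`), a compact `Λ₀ ⊆ {λ ∣ λσ(λ) = 1}` (the windowed `E₁`-eigenvalues) and a closed WINDOW `𝒩 ⊆ M_n(E)` with the SIMPLICITY
property «`ω ∈ 𝒩` unitary with a `λ`-eigenvector, `λ ∈ Λ₀` ⇒ `χ_ω = (X − λ)·q`, `q(λ) ≠ 0`» (at the CM level: `𝒩 = {charpoly ∈ N}`, `N` a small clopen neighbourhood of
`(X−a)²(X−u)`; conjugation-invariant).  THEN for every compact `Ω ⊆ M_n(E)` there is a compact `C ⊆ U(σ,J)` such that: whenever `m ∈ U(σ,J)` has `m v₁ = λ v₁` with `λ ∈ Λ₀`,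
and `x ∈ U(σ,J)` conjugates it into `Ω ∩ 𝒩` (`x m x⁻¹ ∈ Ω ∩ 𝒩`), then `x ∈ C · Stab(v₁)` — i.e. `∃ c ∈ C, (c⁻¹x) v₁ = v₁`.  Since `Stab(v₁) ≤ Stab(E v₁) = Z(ε₀) = M`, this
is «compact modulo `M`» for the windowed `U_M`.
PROOF = ⊙ (F-eig) `isCompact_setOf_hermForm_eq_and_exists_eigen` (the `x v₁` are `λ`-eigenvectors of `x m x⁻¹ ∈ Ω ∩ 𝒩 ∩ U` of value `β`; that set `W` is compact under the GUARD)
+ ⊙ (F-guard) `hermForm_self_ne_zero_of_eigen_simple` (the GUARD from SIMPLICITY) + ★ (F-sec) `exists_isCompact_forall_mulVec_mem_imp` (local sections ⇒ `C`).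

* §1 `isClosed_setOf_exists_mem_unitaryGroupOfForm_coe_eq` — the matrix image of `U(σ, J)` is closed.
* §2 **`exists_isCompact_conj_mem_imp_mem_mul_stab`** — the statement above.

HONEST SCOPE.  Field level only; the CM dress (`(cmDatum L 3 H′).Local v` through the one-place model, `𝒩` from the clopen charpoly window, `Λ₀` from the frame) is the
consumer's 60-line instantiation, token shapes pending F0P2-p02 (g8)'s census v2.  HC_CM is proved only modulo the printed citations until rung 0 closes.

## References
* [HarishChandra1970] Harish-Chandra (notes by G. van Dijk), *Harmonic Analysis on Reductive p-adic Groups*, LNM 162 (1970), Part I §3 Lemma 19 + Corollary; Part II §5.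
* [Dieudonne1971GroupesClassiques] J. Dieudonné, *La géométrie des groupes classiques*, 3e éd. (1971), Chap. II §4.
-/

set_option autoImplicit false

noncomputable section

open Set Filter Topology Matrix Polynomial

namespace Literature.NumberTheory.Automorphic.UnitaryGroup

variable {E : Type*} [NontriviallyNormedField E] {n : Type*} [Fintype n] [DecidableEq n] (σ : E →+* E) (J : Matrix n n E)

/-! ## §1 The matrix image of the unitary group is closed -/

/-- **`{ω ∣ ∃ g ∈ U(σ, J), ↑g = ω}` is closed**: it is `{ω ∣ J⁻¹ σ(ω)ᵀ J ω = 1}` (★ `exists_mem_unitaryGroupOfForm_coe_eq`, ★ `mem_unitaryGroupOfForm_iff_formAdjoint_mul_eq_one`),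
a closed condition for continuous `σ`. [cite: Dieudonne1971GroupesClassiques, Chap. II §4] -/
theorem isClosed_setOf_exists_mem_unitaryGroupOfForm_coe_eq (hσc : Continuous σ) (hJ : IsUnit J.det) :
    IsClosed {ω : Matrix n n E | ∃ g ∈ unitaryGroupOfForm σ J, (g : Matrix n n E) = ω} := by
  have heq : {ω : Matrix n n E | ∃ g ∈ unitaryGroupOfForm σ J, (g : Matrix n n E) = ω} = {ω | J⁻¹ * (ω.map σ)ᵀ * J * ω = 1} := by
    ext ω
    constructor
    · rintro ⟨g, hg, rfl⟩
      exact (Literature.LinearAlgebra.Matrix.mem_unitaryGroupOfForm_iff_formAdjoint_mul_eq_one σ hJ g).1 hg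
    · intro h
      exact Literature.LinearAlgebra.Matrix.exists_mem_unitaryGroupOfForm_coe_eq σ hJ h
  rw [heq]
  exact isClosed_eq ((continuous_const.mul ((continuous_id.matrix_map hσc).matrix_transpose)).mul continuous_const |>.mul continuous_id) continuous_const

/-! ## §2 Compactness modulo the stabiliser -/

/-- **HARISH-CHANDRA'S COMPACTNESS LEMMA AT A SINGULAR SEMISIMPLE POINT, FIELD LEVEL.**  See the module docstring: for compact `Ω` there is a compact `C ⊆ U(σ, J)` with
`x ∈ C · Stab(v₁)` whenever `x ∈ U(σ,J)` conjugates some `m ∈ U(σ,J)` having `m v₁ = λ v₁`, `λ ∈ Λ₀`, into `Ω ∩ 𝒩`.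
[cite: HarishChandra1970, Part I §3 Lemma 19; Part II §5] [cite: Dieudonne1971GroupesClassiques, Chap. II §4] -/
theorem exists_isCompact_conj_mem_imp_mem_mul_stab [ProperSpace E] (hσ : ∀ s, σ (σ s) = s) (hσc : Continuous σ) (hσi : ∀ x, ‖σ x‖ = ‖x‖)
    (hH : (J.map σ)ᵀ = J) (hJd : J.det ≠ 0) (h2 : (2 : E) ≠ 0) {v₁ : n → E} (hβ : hermForm σ J v₁ v₁ ≠ 0)
    {Λ₀ : Set E} (hΛc : IsCompact Λ₀) (hΛ : ∀ l ∈ Λ₀, l * σ l = 1)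
    {𝒩 : Set (Matrix n n E)} (hNc : IsClosed 𝒩)
    (hsimple : ∀ ω ∈ 𝒩, ∀ g ∈ unitaryGroupOfForm σ J, (g : Matrix n n E) = ω → ∀ l ∈ Λ₀, ∀ e : n → E, e ≠ 0 → ω *ᵥ e = l • e →
      ∃ q : E[X], ω.charpoly = (X - C l) * q ∧ q.eval l ≠ 0)
    {Ω : Set (Matrix n n E)} (hΩ : IsCompact Ω) :
    ∃ C : Set ↥(unitaryGroupOfForm σ J), IsCompact C ∧
      ∀ x m : ↥(unitaryGroupOfForm σ J), (∃ l ∈ Λ₀, ((m : GL n E) : Matrix n n E) *ᵥ v₁ = l • v₁) →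
        (((x * m * x⁻¹ : ↥(unitaryGroupOfForm σ J)) : GL n E) : Matrix n n E) ∈ Ω ∩ 𝒩 →
        ∃ c ∈ C, ((((c⁻¹ * x : ↥(unitaryGroupOfForm σ J))) : GL n E) : Matrix n n E) *ᵥ v₁ = v₁ := by
  have hJ : IsUnit J.det := (Ne.isUnit hJd)
  -- the compact set of admissible operators
  set Ω' : Set (Matrix n n E) := Ω ∩ (𝒩 ∩ {ω | ∃ g ∈ unitaryGroupOfForm σ J, (g : Matrix n n E) = ω}) with hΩ'
  have hΩ'c : IsCompact Ω' := hΩ.inter_right (hNc.inter (isClosed_setOf_exists_mem_unitaryGroupOfForm_coe_eq σ J hσc hJ))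
  -- the GUARD on `Ω' × Λ₀`
  have hguard : ∀ ω ∈ Ω', ∀ l ∈ Λ₀, ∀ e : n → E, ω *ᵥ e = l • e → hermForm σ J e e = 0 → e = 0 := by
    rintro ω ⟨-, hωN, g, hg, rfl⟩ l hl e he h0
    by_contra he0
    obtain ⟨q, hχ, hq⟩ := hsimple _ hωN g hg rfl l hl e he0 he
    exact hermForm_self_ne_zero_of_eigen_simple σ J hJd hg he0 he (hΛ l hl) hχ hq h0
  -- the compact `W` of windowed eigenvectors on the sphere `{h = β}`
  have hW := isCompact_setOf_hermForm_eq_and_exists_eigen σ J hσc hσi hΩ'c hΛc hβ hguard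
  -- local sections ⇒ the compact `C`
  obtain ⟨C, hCc, hC⟩ := exists_isCompact_forall_mulVec_mem_imp σ J hσ hσc hH h2 hβ hW (fun w hw => hw.1)
  refine ⟨C, hCc, fun x m hm hxm => hC x ⟨?_, ?_⟩⟩
  · -- `h(x v₁, x v₁) = β`
    exact (mem_unitaryGroupOfForm_iff_hermForm σ J (x : GL n E)).1 x.2 v₁ v₁
  · -- `x v₁` is a `λ`-eigenvector of `x m x⁻¹ ∈ Ω'`
    obtain ⟨l, hl, hml⟩ := hm
    refine ⟨_, ⟨hxm.1, hxm.2, (x * m * x⁻¹ : ↥(unitaryGroupOfForm σ J)), (x * m * x⁻¹).2, rfl⟩, l, hl, ?_⟩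
    rw [Subgroup.coe_mul, Subgroup.coe_mul, Units.val_mul, Units.val_mul, ← Matrix.mulVec_mulVec, ← Matrix.mulVec_mulVec, Subgroup.coe_inv]
    have hinv : (((x : GL n E)⁻¹ : GL n E) : Matrix n n E) *ᵥ (((x : GL n E) : Matrix n n E) *ᵥ v₁) = v₁ := by
      rw [Matrix.mulVec_mulVec, ← Units.val_mul, inv_mul_cancel, Units.val_one, Matrix.one_mulVec]
    rw [hinv, hml, Matrix.mulVec_smul]

end Literature.NumberTheory.Automorphic.UnitaryGroup
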